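import Mathlib
import Literature.NumberTheory.LFunctions.Zhang2022.SkeletonPartOne
import Literature.NumberTheory.LFunctions.Zhang2022.SkeletonAssembly
import Literature.NumberTheory.LFunctions.Zhang2022.SkeletonPartOneC
import Literature.NumberTheory.LFunctions.DirichletLFunctionZeroReflection
import HarnessLib

/-!
# Zhang (2022), typed skeleton: the mechanism of the §4 deduction of Proposition 2.2 —
# zeros of `L(s,ψ)L(s,ψχ)` near `Ω` on the line, simple, with gaps `α + O(α²𝓛)` (node `Z22:Ded22`)

Topic `Literature/NumberTheory/LFunctions/Zhang2022` (Landau–Siegel audit tree; verdict-neutral).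
Y. Zhang, *Discrete mean estimates and the Landau–Siegel zero*, arXiv:2211.02515v1 (2022)
[Zhang2022LandauSiegel] — **an unrefereed manuscript under adjudication**; `Lemma42`, `Lemma45`,
`Lemma46 c′`, `Lemma47 c′`, `Prop22 c′` are the skeleton's CLAIM nodes, stated not asserted. This
file holds the POINTWISE lemmas (one `D`, one `ψ ∈ Ψ₁`, all inputs as explicit hypotheses) behind
the two-sentence deduction of §4, PDF p. 23, tex L1263–L1264:

> Lemma 4.5 and 4.6 together imply the assertions (i) and (ii) of Proposition 2.2. […] To complete
> the proof of the gap assertion (iii), it now suffices to prove [Lemma 4.7].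

The edge itself (`prop22_of_repaired`, over the REPAIRED antecedents of GAP row G-d15-1) is in
`Zhang2022/Section4Prop22Edge`. Proved here:

* `re_eq_half_of_LL_eq_zero` — (i): if `𝒜 ≠ 0` for `1/2 + α² ≤ σ < 1` (Lemma 4.5, CLOSED range) and
  zeros `ρ` of `𝒜` with `1/2 ≤ β < 1/2 + α²` have `β = 1/2` (Lemma 4.6), both on the window
  `|t − 2πt₀| < 𝓛₁ + 5/2`, and the zeros of `L(s,ψ)L(s,ψχ)` with `σ > 0` are symmetric under
  `s ↦ 1 − s̄` (`LL_one_sub_conj_eq_zero`: the tree's `LFunction_one_sub_conj_eq_zero` for the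
  primitive `ψ (mod p)`, `ψχ (mod Dp)`), then every zero with `0 < σ < 1` in the window is on
  `σ = 1/2` (a zero of `L(s,ψ)L(s,ψχ)` is a zero of `𝒜 = L(s,ψ)L(s,ψχ)/F`; `Ω ⊄ Ω₁`, so zeros with
  `β < 1/2` are reflected first);
* `deriv_LL_ne_zero` — (ii): at a zero `ρ` with `F(ρ) ≠ 0`, `𝒜′(ρ) = (LL)′(ρ)/F(ρ)`;
* `companion_facts`, `gap_lt_of_three_zeros`, `gap_gt_of_punctured_disc`,
  `gap_ge_of_open_punctured_disc` — (iii): for consecutive zeros `ρ, ρ′ ∈ Ω` on the line, the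
  three zeros `ρ + w`, `|w| < R₊ = α(1 + c′α𝓛)`, of Lemma 4.7 are `0` and two purely imaginary `w`
  (on the line by (i)) with `R₋ ≤ |w| < R₊`, `R₋ = α(1 − c′α𝓛)` (Lemma 4.6 (iii) at `ρ`); both
  below `ρ` is impossible (Lemma 4.6 (iii) at the upper one, `R₊ − R₋ ≤ R₋`), so `γ′ − γ < R₊`;
  and `γ′ − γ ≥ R₋` (PRINTED open punctured disc) resp. `> R₋` (closed) as `i(γ′ − γ)` is one of
  the three;
* bookkeeping: `alpha_eq_pi_div` (`α = π/𝓛⁹`), `abs_mul_alpha_mul_ell_le`, `two_alpha_le`,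
  `radii_bounds`, `mem_Omega_iff'`.

What is NOT asserted: any of Lemmas 4.2, 4.5–4.7 or Proposition 2.2 (every analytic input is a
hypothesis); nothing about Theorems 1–2 of the source; nothing bearing on the verdict on (8.24).

## References

* Y. Zhang, arXiv:2211.02515v1 (2022), §2 Proposition 2.2 (PDF p. 7, tex L406–L421), §4 Lemmas
  4.2, 4.5–4.7 and the deduction p. 23 (tex L1129–L1277). [cite: Zhang2022LandauSiegel, §4 p. 23]
* H. L. Montgomery, R. C. Vaughan, *Multiplicative Number Theory I* (2007), §10.1 (reflection of
  zeros). [cite: MontgomeryVaughan2007, §10.1]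
-/

noncomputable section

open Complex Real ComplexConjugate

namespace Literature.NumberTheory.LFunctions.Zhang2022.Skeleton

/-! ## Parameter bookkeeping for large `D` -/

section Params
variable {D : ℕ}

/-- `F(s,ψ)` is entire (a finite Dirichlet polynomial; local copy of `Skeleton.differentiable_Fpoly`
of `Section4Lemma43Edge`). [cite: Zhang2022LandauSiegel, §4 Lemma 4.3 (proof)] -/
private theorem differentiable_Fpoly' (χ : DirichletCharacter ℂ D) (x : Chr D) :
    Differentiable ℂ (Fpoly χ x) := by
  have h : Fpoly χ x = fun s => ∑ n ∈ Finset.Icc 1 (D ^ 4),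
      nu χ n * x.ψ (n : ZMod x.p) * (n : ℂ) ^ (-s) := rfl
  rw [h]
  refine Differentiable.fun_sum fun n hn => ?_
  have hn0 : (n : ℂ) ≠ 0 := by
    exact_mod_cast Nat.one_le_iff_ne_zero.mp (Finset.mem_Icc.mp hn).1
  exact (differentiable_id.neg.const_cpow (Or.inl hn0)).const_mul _

/-- `α = π/𝓛⁹` ((2.10) with (2.6): `log P = 𝓛⁹`). [cite: Zhang2022LandauSiegel, §2 (2.10)] -/
theorem alpha_eq_pi_div (D : ℕ) : alpha D = Real.pi / ell D ^ 9 := by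
  rw [alpha, bigP, Real.log_exp]

/-- For `𝓛 ≥ 1` and `3π|c′| ≤ 𝓛`: `|c′|·α·𝓛 ≤ 1/3` (`α𝓛 = π/𝓛⁸ ≤ π/𝓛`).
[cite: Zhang2022LandauSiegel, §2 (2.10)] -/
theorem abs_mul_alpha_mul_ell_le {c' : ℝ} (hℓ : 1 ≤ ell D) (hc : 3 * Real.pi * |c'| ≤ ell D) :
    |c'| * alpha D * ell D ≤ 1 / 3 := by
  have hℓ0 : 0 < ell D := by linarith
  rw [alpha_eq_pi_div]
  have h8 : ell D ≤ ell D ^ 8 := le_self_pow₀ hℓ (by norm_num)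
  have hpow : 0 < ell D ^ 8 := by positivity
  have e : |c'| * (Real.pi / ell D ^ 9) * ell D = Real.pi * |c'| / ell D ^ 8 := by
    field_simp
  rw [e, div_le_iff₀ hpow]
  nlinarith [abs_nonneg c', Real.pi_pos.le]

/-- For `𝓛 ≥ 4`: `2α ≤ 1/(100𝓛)` (`200π ≤ 𝓛⁸`). [cite: Zhang2022LandauSiegel, §2 (2.10)] -/
theorem two_alpha_le (hℓ : 4 ≤ ell D) : 2 * alpha D ≤ 1 / (100 * ell D) := by
  have hℓ0 : 0 < ell D := by linarith
  rw [alpha_eq_pi_div, mul_div_assoc', div_le_div_iff₀ (by positivity) (by positivity)]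
  have hπ : Real.pi < 4 := Real.pi_lt_four
  have h2 : (4 : ℝ) ^ 8 ≤ ell D ^ 8 := pow_le_pow_left₀ (by norm_num) hℓ 8
  have e9 : ell D ^ 9 = ell D ^ 8 * ell D := by ring
  rw [e9]
  nlinarith

/-- The radii `R± = α(1 ± c′α𝓛)` for `|c′|α𝓛 ≤ 1/3` (`α, 𝓛 > 0`): `R₊ ≤ 2α`, `(2/3)α ≤ R₋`,
`R₊ − R₋ ≤ R₋`, `(2/3)α ≤ R₊`. [cite: Zhang2022LandauSiegel, §4 Lemmas 4.6–4.7] -/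
theorem radii_bounds {c' : ℝ} (hα : 0 < alpha D) (hℓ : 0 < ell D)
    (hc : |c'| * alpha D * ell D ≤ 1 / 3) :
    alpha D * (1 + c' * alpha D * ell D) ≤ 2 * alpha D ∧
      2 / 3 * alpha D ≤ alpha D * (1 - c' * alpha D * ell D) ∧
      alpha D * (1 + c' * alpha D * ell D) - alpha D * (1 - c' * alpha D * ell D)
        ≤ alpha D * (1 - c' * alpha D * ell D) ∧
      2 / 3 * alpha D ≤ alpha D * (1 + c' * alpha D * ell D) := by
  have hαℓ : 0 ≤ alpha D * ell D := by positivity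
  have h1 : c' * (alpha D * ell D) ≤ |c'| * (alpha D * ell D) :=
    mul_le_mul_of_nonneg_right (le_abs_self c') hαℓ
  have h2 : -|c'| * (alpha D * ell D) ≤ c' * (alpha D * ell D) :=
    mul_le_mul_of_nonneg_right (neg_abs_le c') hαℓ
  have hc' : |c'| * (alpha D * ell D) ≤ 1 / 3 := by
    calc |c'| * (alpha D * ell D) = |c'| * alpha D * ell D := by ring
      _ ≤ 1 / 3 := hc
  have hu : c' * alpha D * ell D ≤ 1 / 3 := by nlinarith
  have hl : -(1 / 3) ≤ c' * alpha D * ell D := by nlinarith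
  refine ⟨by nlinarith, by nlinarith, by nlinarith, by nlinarith⟩

/-- A purely imaginary number has norm `|Im w|`. [folklore] -/
private theorem norm_eq_abs_im_of_re_eq_zero {w : ℂ} (h : w.re = 0) : ‖w‖ = |w.im| := by
  have e : w = (w.im : ℂ) * I := by
    apply Complex.ext <;> simp [h]
  rw [congrArg (fun z : ℂ => ‖z‖) e]
  simp

end Params

/-! ## The zeros of `L(s,ψ)L(s,ψχ)` near `Ω`: on the line, simple, with gaps `α + O(α²𝓛)` -/

section Deduction
variable {D : ℕ} [NeZero D] {χ : DirichletCharacter ℂ D} {x : Chr D} {c' : ℝ}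

omit [NeZero D] in
/-- `Ω = {|σ − 1/2| < 1/2, |t − 2πt₀| < 𝓛₁ + 2}` unfolded ((2.7), `s₀ = 1/2 + 2πit₀`).
[cite: Zhang2022LandauSiegel, §2 (2.7)] -/
theorem mem_Omega_iff' (s : ℂ) :
    s ∈ Omega D ↔ |s.re - 1 / 2| < 1 / 2 ∧ |s.im - 2 * π * t0 D| < ell1 D + 2 := by
  simp only [Omega, Set.mem_setOf_eq, Complex.sub_re, Complex.sub_im, s0_re, s0_im]

/-- **"all the zeros … lie on the critical line" — the mechanism of (i)**, over the repaired
Lemmas 4.5/4.6 at one `D` and one `ψ`: if `𝒜 ≠ 0` for `1/2 + α² ≤ σ < 1` and every zero `ρ` of `𝒜`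
with `1/2 ≤ β < 1/2 + α²` has `β = 1/2` (both on the window `|t − 2πt₀| < 𝓛₁ + 5/2`), and the zeros
of `L(s,ψ)L(s,ψχ)` with `σ > 0` are symmetric under `s ↦ 1 − s̄`, then every zero with `0 < σ < 1` in
that window lies on `σ = 1/2` (zeros with `β < 1/2` are reflected first; a zero of
`L(s,ψ)L(s,ψχ)` is a zero of `𝒜 = L(s,ψ)L(s,ψχ)/F`). [cite: Zhang2022LandauSiegel, §4 p. 23] -/
theorem re_eq_half_of_LL_eq_zero
    (h45D : ∀ s : ℂ, 1 / 2 + alpha D ^ 2 ≤ s.re → s.re < 1 →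
      |s.im - 2 * π * t0 D| < ell1 D + 5 / 2 → calA χ x s ≠ 0)
    (h46D : ∀ ρ : ℂ, calA χ x ρ = 0 → 1 / 2 ≤ ρ.re → ρ.re < 1 / 2 + alpha D ^ 2 →
      |ρ.im - 2 * π * t0 D| < ell1 D + 5 / 2 → ρ.re = 1 / 2)
    (hrefl : ∀ s : ℂ, 0 < s.re → LL χ x s = 0 → LL χ x (1 - conj s) = 0)
    {s : ℂ} (h0 : 0 < s.re) (h1 : s.re < 1) (hw : |s.im - 2 * π * t0 D| < ell1 D + 5 / 2)
    (hz : LL χ x s = 0) : s.re = 1 / 2 := by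
  have key : ∀ z : ℂ, 1 / 2 ≤ z.re → z.re < 1 → |z.im - 2 * π * t0 D| < ell1 D + 5 / 2 →
      LL χ x z = 0 → z.re = 1 / 2 := by
    intro z hz1 hz2 hzw hzz
    have hA : calA χ x z = 0 := by
      simp only [calA, hzz, zero_div]
    by_cases hge : 1 / 2 + alpha D ^ 2 ≤ z.re
    · exact absurd hA (h45D z hge hz2 hzw)
    · exact h46D z hA hz1 (lt_of_not_ge hge) hzw
  by_cases hs : 1 / 2 ≤ s.re
  · exact key s hs h1 hw hz
  · have hre : (1 - conj s).re = 1 - s.re := by simp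
    have him : (1 - conj s).im = s.im := by simp
    have h := key (1 - conj s) (by rw [hre]; linarith) (by rw [hre]; linarith)
      (by rw [him]; exact hw) (hrefl s h0 hz)
    rw [hre] at h
    linarith

/-- **"all the zeros … are simple" — the mechanism of (ii)**: at a zero `ρ` of `L(s,ψ)L(s,ψχ)` with
`F(ρ,ψ) ≠ 0`, `𝒜 = L(s,ψ)L(s,ψχ)/F` has `𝒜′(ρ) = (L(s,ψ)L(s,ψχ))′(ρ)/F(ρ)`, so `𝒜′(ρ) ≠ 0`
(Lemma 4.6) forces a simple zero. [cite: Zhang2022LandauSiegel, §4 p. 23, tex L1263] -/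
theorem deriv_LL_ne_zero (hD : 3 ≤ D) (hp : χ.IsPrimitive) {s : ℂ} (hF : Fpoly χ x s ≠ 0)
    (hz : LL χ x s = 0) (hA : deriv (calA χ x) s ≠ 0) : deriv (LL χ x) s ≠ 0 := by
  have hψ1 : x.ψ ≠ 1 := x.ψ_ne_one
  have hDp : D * x.p ≠ 1 :=
    (lt_of_lt_of_le (by omega : 1 < D) (Nat.le_mul_of_pos_right D x.prime.pos)).ne'
  have hpc1 : psiChi χ x ≠ 1 :=
    GammaFactor.ne_one_of_isPrimitive (psiChiPrimitive_holds D χ x hD hp) hDp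
  have hLLd : DifferentiableAt ℂ (LL χ x) s :=
    ((DirichletCharacter.differentiable_LFunction hψ1).differentiableAt).mul
      ((DirichletCharacter.differentiable_LFunction hpc1).differentiableAt)
  have hFd : DifferentiableAt ℂ (Fpoly χ x) s := differentiable_Fpoly' χ x s
  have hquot : HasDerivAt (calA χ x)
      ((deriv (LL χ x) s * Fpoly χ x s - LL χ x s * deriv (Fpoly χ x) s) / Fpoly χ x s ^ 2) s :=
    hLLd.hasDerivAt.div hFd.hasDerivAt hF
  intro hzero
  apply hA
  rw [hquot.deriv, hzero, hz]
  simp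

/-- **"the zeros … are symmetric under `s ↦ 1 − s̄`"** for `σ > 0` (functional equation (4.4) and
`conj L(s̄,ψ) = L(s,ψ̄)`, for the primitive characters `ψ (mod p)` and `ψχ (mod Dp)`; the tree's
`LFunction_one_sub_conj_eq_zero`, adjudication item R2-3). [cite: Zhang2022LandauSiegel, §4 (4.4)] -/
theorem LL_one_sub_conj_eq_zero (hD : 3 ≤ D) (hp : χ.IsPrimitive) (x : Chr D) {s : ℂ}
    (hs : 0 < s.re) (hz : LL χ x s = 0) : LL χ x (1 - conj s) = 0 := by
  have hpc : (psiChi χ x).IsPrimitive := psiChiPrimitive_holds D χ x hD hp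
  have hDp : D * x.p ≠ 1 :=
    (lt_of_lt_of_le (by omega : 1 < D) (Nat.le_mul_of_pos_right D x.prime.pos)).ne'
  unfold LL at hz ⊢
  rcases mul_eq_zero.mp hz with h | h
  · rw [LFunction_one_sub_conj_eq_zero x.prim x.p_ne_one h hs, zero_mul]
  · rw [LFunction_one_sub_conj_eq_zero hpc hDp h hs, mul_zero]

/-- The companions of a zero `ρ = 1/2 + iγ` (`|γ − 2πt₀| < 𝓛₁ + 2`): for `|w| < R` with `R < 1/2`,
`R ≤ log𝓛/(100𝓛)`, the point `ρ + w` lies in `Ω₁` (so `𝒜(ρ+w) = 0 ↔ L(s,ψ)L(s,ψχ)(ρ+w) = 0` once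
`F ≠ 0` on `Ω₁`, Lemma 4.2) and inside the window `𝓛₁ + 5/2`, hence ON THE LINE if it is a zero
(by (i) on the wider window): `Re w = 0`. [cite: Zhang2022LandauSiegel, §4 p. 23] -/
theorem companion_facts {s : ℂ} {R : ℝ} (hsre : s.re = 1 / 2)
    (hsim : |s.im - 2 * π * t0 D| < ell1 D + 2) (hR_half : R < 1 / 2)
    (hR_log : R ≤ Real.log (ell D) / (100 * ell D))
    (hF0 : ∀ z ∈ Omega1 D, Fpoly χ x z ≠ 0)
    (hline : ∀ z : ℂ, 0 < z.re → z.re < 1 → |z.im - 2 * π * t0 D| < ell1 D + 5 / 2 →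
      LL χ x z = 0 → z.re = 1 / 2)
    {w : ℂ} (hw : ‖w‖ < R) :
    (calA χ x (s + w) = 0 ↔ LL χ x (s + w) = 0) ∧ (calA χ x (s + w) = 0 → w.re = 0) := by
  obtain ⟨h1a, h1b⟩ := abs_le.mp (Complex.abs_re_le_norm w)
  obtain ⟨h2a, h2b⟩ := abs_le.mp (Complex.abs_im_le_norm w)
  obtain ⟨hi1, hi2⟩ := abs_lt.mp hsim
  have hΩ1 : s + w ∈ Omega1 D := by
    rw [Omega1, Lemma43.mem_Omega1_iff, Complex.add_re, Complex.add_im, hsre]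
    refine ⟨by linarith, by linarith, ?_⟩
    rw [abs_lt]
    constructor <;> linarith
  have hiff : calA χ x (s + w) = 0 ↔ LL χ x (s + w) = 0 := by
    rw [calA, div_eq_zero_iff, or_iff_left (hF0 _ hΩ1)]
  refine ⟨hiff, fun hA => ?_⟩
  have hLL := hiff.mp hA
  have h := hline (s + w) (by rw [Complex.add_re]; linarith) (by rw [Complex.add_re]; linarith)
    (by rw [Complex.add_im, abs_lt]; constructor <;> linarith) hLL
  rw [Complex.add_re, hsre] at h
  linarith

/-- **The counting step of (iii), first half**: for consecutive zeros `ρ = 1/2 + iγ`, `ρ′ = 1/2 + iγ′`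
(`γ < γ′`) of `L(s,ψ)L(s,ψχ)` in `Ω`, `γ′ − γ < R₊ := α(1 + c′α𝓛)`. For otherwise the three zeros
`ρ + w`, `|w| < R₊`, of Lemma 4.7 are `w = 0` and two purely imaginary `w` (on the line by (i)) of
modulus in `(R₋, R₊)` (`R₋ := α(1 − c′α𝓛)`, Lemma 4.6 (iii) at `ρ`, closed disc); both below `ρ` is
impossible (Lemma 4.6 (iii) at the upper one: their distance is `≤ R₊ − R₋ ≤ R₋`), and one above `ρ`
is a zero of `L(s,ψ)L(s,ψχ)` in `Ω` strictly between `ρ` and `ρ′`.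
[cite: Zhang2022LandauSiegel, §4 p. 23, tex L1263–L1264] -/
theorem gap_lt_of_three_zeros {s s' : ℂ} {Rp Rm : ℝ} (hα : 0 < alpha D)
    (hRR : Rp - Rm ≤ Rm) (hR_half : Rp < 1 / 2) (hR_log : Rp ≤ Real.log (ell D) / (100 * ell D))
    (hF0 : ∀ z ∈ Omega1 D, Fpoly χ x z ≠ 0)
    (hline : ∀ z : ℂ, 0 < z.re → z.re < 1 → |z.im - 2 * π * t0 D| < ell1 D + 5 / 2 →
      LL χ x z = 0 → z.re = 1 / 2)
    (h46D : ∀ ρ : ℂ, calA χ x ρ = 0 → 1 / 2 ≤ ρ.re → ρ.re < 1 / 2 + alpha D ^ 2 →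
      |ρ.im - 2 * π * t0 D| < ell1 D + 5 / 2 →
        ∀ w : ℂ, 0 < ‖w‖ → ‖w‖ < Rm → calA χ x (ρ + w) ≠ 0)
    (hT3 : {w : ℂ | ‖w‖ < Rp ∧ calA χ x (s + w) = 0}.ncard = 3)
    (hsre : s.re = 1 / 2) (hsim : |s.im - 2 * π * t0 D| < ell1 D + 2) (hsz : LL χ x s = 0)
    (hs'im : |s'.im - 2 * π * t0 D| < ell1 D + 2) (hlt : s.im < s'.im)
    (hcons : ∀ s'' ∈ prodZeroSetOmega χ x, ¬ (s.im < s''.im ∧ s''.im < s'.im)) :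
    s'.im - s.im < Rp := by
  set T : Set ℂ := {w : ℂ | ‖w‖ < Rp ∧ calA χ x (s + w) = 0} with hT_def
  obtain ⟨hi1, hi2⟩ := abs_lt.mp hsim
  obtain ⟨hi1', hi2'⟩ := abs_lt.mp hs'im
  -- facts about the elements of `T`
  have hfacts : ∀ w ∈ T, (LL χ x (s + w) = 0) ∧ w.re = 0 := by
    intro w hw
    have h := companion_facts hsre hsim hR_half hR_log hF0 hline hw.1
    exact ⟨h.1.mp hw.2, h.2 hw.2⟩
  have hT3' : T.ncard = 3 := hT3
  have hRp0 : 0 < Rp := by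
    obtain ⟨a, b, c, -, -, -, habc⟩ := Set.ncard_eq_three.mp hT3'
    have ha : a ∈ T := by rw [habc]; exact Set.mem_insert _ _
    exact lt_of_le_of_lt (norm_nonneg a) ha.1
  have hA0 : calA χ x s = 0 := by
    have h := (companion_facts hsre hsim hR_half hR_log hF0 hline
      (w := 0) (by rw [norm_zero]; exact hRp0)).1
    rw [add_zero] at h
    exact h.mpr hsz
  have hdisc := h46D s hA0 hsre.symm.le (by rw [hsre]; nlinarith)
    (by rw [abs_lt]; constructor <;> linarith)
  have hT_norm : ∀ w ∈ T, w ≠ 0 → Rm ≤ ‖w‖ := by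
    intro w hw hne
    by_contra hlt'
    push Not at hlt'
    exact hdisc w (norm_pos_iff.mpr hne) hlt' hw.2
  have hT_im : ∀ w ∈ T, w ≠ 0 → w.im ≠ 0 := by
    intro w hw hne him
    exact hne (Complex.ext (by rw [(hfacts w hw).2]; rfl) (by rw [him]; rfl))
  by_contra hge
  push Not at hge
  have h0T : (0 : ℂ) ∈ T := ⟨by rw [norm_zero]; exact hRp0, by rw [add_zero]; exact hA0⟩
  have hT2 : (T \ {0}).ncard = 2 := by
    rw [Set.ncard_sdiff_singleton_of_mem h0T, hT3']
  obtain ⟨u, v, huv, huv_eq⟩ := Set.ncard_eq_two.mp hT2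
  have hu : u ∈ T \ {0} := by rw [huv_eq]; exact Set.mem_insert _ _
  have hv : v ∈ T \ {0} := by rw [huv_eq]; exact Set.mem_insert_of_mem _ rfl
  obtain ⟨huT, hu0⟩ := hu
  obtain ⟨hvT, hv0⟩ := hv
  rw [Set.mem_singleton_iff] at hu0 hv0
  -- one of `u`, `v` lies above `ρ`
  have hpos : ∃ p ∈ T, 0 < p.im := by
    by_contra hnone
    push Not at hnone
    have hui : u.im < 0 := lt_of_le_of_ne (hnone u huT) (hT_im u huT hu0)
    have hvi : v.im < 0 := lt_of_le_of_ne (hnone v hvT) (hT_im v hvT hv0)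
    have hun : ‖u‖ = |u.im| := norm_eq_abs_im_of_re_eq_zero (hfacts u huT).2
    have hvn : ‖v‖ = |v.im| := norm_eq_abs_im_of_re_eq_zero (hfacts v hvT).2
    have hu1 := hT_norm u huT hu0
    have hu2 := huT.1
    have hv1 := hT_norm v hvT hv0
    have hv2 := hvT.1
    rw [hun, abs_of_neg hui] at hu1 hu2
    rw [hvn, abs_of_neg hvi] at hv1 hv2
    obtain ⟨-, h2b⟩ := abs_le.mp (Complex.abs_im_le_norm u)
    -- Lemma 4.6 (iii) at the zero `s + u`
    have hure : (s + u).re = 1 / 2 := by rw [Complex.add_re, hsre, (hfacts u huT).2, add_zero]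
    have hdisc1 := h46D (s + u) huT.2 hure.symm.le (by rw [hure]; nlinarith)
      (by rw [Complex.add_im, abs_lt]; constructor <;> linarith)
    have hvu_re : (v - u).re = 0 := by
      rw [Complex.sub_re, (hfacts u huT).2, (hfacts v hvT).2, sub_zero]
    have hvu : ‖v - u‖ = |v.im - u.im| := by
      rw [norm_eq_abs_im_of_re_eq_zero hvu_re, Complex.sub_im]
    have hne : 0 < ‖v - u‖ := norm_pos_iff.mpr (sub_ne_zero.mpr huv.symm)
    obtain ⟨-, hub⟩ := abs_le.mp (Complex.abs_im_le_norm u)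
    obtain ⟨-, hvb⟩ := abs_le.mp (Complex.abs_im_le_norm v)
    have hlt' : ‖v - u‖ < Rm := by
      rw [hvu, abs_lt]
      constructor <;> linarith
    have e : s + u + (v - u) = s + v := by ring
    exact hdisc1 (v - u) hne hlt' (by rw [e]; exact hvT.2)
  obtain ⟨p, hpT, hpim⟩ := hpos
  have hpn : ‖p‖ = |p.im| := norm_eq_abs_im_of_re_eq_zero (hfacts p hpT).2
  have hp2 : p.im < Rp := by
    have h := hpT.1
    rw [hpn, abs_of_pos hpim] at h
    exact h
  have hzΩ : s + p ∈ Omega D := by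
    rw [mem_Omega_iff', Complex.add_re, Complex.add_im, hsre, (hfacts p hpT).2]
    refine ⟨by norm_num, ?_⟩
    rw [abs_lt]
    constructor <;> linarith
  exact hcons (s + p) ⟨hzΩ, (hfacts p hpT).1⟩
    ⟨by rw [Complex.add_im]; linarith, by rw [Complex.add_im]; linarith⟩

/-- **The counting step of (iii), second half**: with `γ′ − γ < R₊`, `ρ′ − ρ = i(γ′ − γ)` is one of
the zeros `w` of `𝒜(ρ + w)`, `|w| < R₊`, and Lemma 4.6 (iii) at `ρ` (CLOSED punctured disc of radius
`R₋`) gives `γ′ − γ > R₋`. [cite: Zhang2022LandauSiegel, §4 p. 23, tex L1263–L1264] -/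
theorem gap_gt_of_punctured_disc {s s' : ℂ} {Rp Rm : ℝ} (hR_half : Rp < 1 / 2)
    (hR_log : Rp ≤ Real.log (ell D) / (100 * ell D))
    (hF0 : ∀ z ∈ Omega1 D, Fpoly χ x z ≠ 0)
    (hline : ∀ z : ℂ, 0 < z.re → z.re < 1 → |z.im - 2 * π * t0 D| < ell1 D + 5 / 2 →
      LL χ x z = 0 → z.re = 1 / 2)
    (hdisc : ∀ w : ℂ, 0 < ‖w‖ → ‖w‖ ≤ Rm → calA χ x (s + w) ≠ 0)
    (hsre : s.re = 1 / 2) (hsim : |s.im - 2 * π * t0 D| < ell1 D + 2)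
    (hs're : s'.re = 1 / 2) (hs'z : LL χ x s' = 0) (hlt : s.im < s'.im)
    (hdlt : s'.im - s.im < Rp) : Rm < s'.im - s.im := by
  have hd0 : 0 < s'.im - s.im := by linarith
  have hre0 : (s' - s).re = 0 := by rw [Complex.sub_re, hsre, hs're, sub_self]
  have hn : ‖s' - s‖ = s'.im - s.im := by
    rw [norm_eq_abs_im_of_re_eq_zero hre0, Complex.sub_im, abs_of_pos hd0]
  have e : s + (s' - s) = s' := by ring
  have hA : calA χ x (s + (s' - s)) = 0 := by
    rw [(companion_facts hsre hsim hR_half hR_log hF0 hline (w := s' - s)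
      (by rw [hn]; exact hdlt)).1, e]
    exact hs'z
  have hne : 0 < ‖s' - s‖ := by rw [hn]; exact hd0
  by_contra hle
  push Not at hle
  exact hdisc (s' - s) hne (by rw [hn]; exact hle) hA

/-- The same with the PRINTED open punctured disc `0 < |w| < R₋` of Lemma 4.6 (iii): only
`γ′ − γ ≥ R₋` (the second seam of GAP row G-d15-1, d02's note: equality is not excluded).
[cite: Zhang2022LandauSiegel, §4 p. 23, tex L1263–L1264] -/
theorem gap_ge_of_open_punctured_disc {s s' : ℂ} {Rp Rm : ℝ} (hR_half : Rp < 1 / 2)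
    (hR_log : Rp ≤ Real.log (ell D) / (100 * ell D))
    (hF0 : ∀ z ∈ Omega1 D, Fpoly χ x z ≠ 0)
    (hline : ∀ z : ℂ, 0 < z.re → z.re < 1 → |z.im - 2 * π * t0 D| < ell1 D + 5 / 2 →
      LL χ x z = 0 → z.re = 1 / 2)
    (hdisc : ∀ w : ℂ, 0 < ‖w‖ → ‖w‖ < Rm → calA χ x (s + w) ≠ 0)
    (hsre : s.re = 1 / 2) (hsim : |s.im - 2 * π * t0 D| < ell1 D + 2)
    (hs're : s'.re = 1 / 2) (hs'z : LL χ x s' = 0) (hlt : s.im < s'.im)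
    (hdlt : s'.im - s.im < Rp) : Rm ≤ s'.im - s.im := by
  have hd0 : 0 < s'.im - s.im := by linarith
  have hre0 : (s' - s).re = 0 := by rw [Complex.sub_re, hsre, hs're, sub_self]
  have hn : ‖s' - s‖ = s'.im - s.im := by
    rw [norm_eq_abs_im_of_re_eq_zero hre0, Complex.sub_im, abs_of_pos hd0]
  have e : s + (s' - s) = s' := by ring
  have hA : calA χ x (s + (s' - s)) = 0 := by
    rw [(companion_facts hsre hsim hR_half hR_log hF0 hline (w := s' - s)
      (by rw [hn]; exact hdlt)).1, e]
    exact hs'z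
  have hne : 0 < ‖s' - s‖ := by rw [hn]; exact hd0
  by_contra hlt'
  push Not at hlt'
  exact hdisc (s' - s) hne (by rw [hn]; exact hlt') hA

end Deduction

end Literature.NumberTheory.LFunctions.Zhang2022.Skeleton
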